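import Literature.MathematicalPhysics.QuantumFieldTheory.Balaban1983to89.B9Eq3132QadjKinvPiSupRowClosed
import Literature.MathematicalPhysics.QuantumFieldTheory.Balaban1983to89.B11Eq88LaplaceH1Identity
import Literature.MathematicalPhysics.QuantumFieldTheory.Balaban1983to89.B9Eq3119DeltaPiCarrier

/-!
# `Balaban1983to89.B11Eq88LaplaceH1CurrentLetter` — T. Bałaban, *The variational problem and background fields in renormalization group method for lattice
# gauge theories*, Commun. Math. Phys. **102** (1985) 277–309 [Balaban1985Variational] (87)–(88) p. 291 («Applying the inequalities (3.132) from [5], (55), (73) …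
# we can estimate this functional derivative by O(1)ε₁(Lʲη)⁻³ on Ω_j»), (129) p. 297; [Balaban1985BackgroundPropagators] (3.132)–(3.133) p. 422, (3.122) p. 420:
# **THE ONE-BLOCK KERNEL LETTER OF THE COMPOSITE `(Δ̃_{a,k} − Q_k†aQ_k)∘H̃_{1,k} = (π†Δ^ηπ + D R_k D*)∘H̃_{1,k}` READ AS A CURRENT-VALUED MAP, ∃-FIRST,
# HEIGHT-FREE** — the lattice-free replacement of the ill-posed W-slot letter `M_Δ = ‖Δπ‖` (NE9 leaf-01 memo `LOCATED-after-g97.md` §2 (E′))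

WHY.  In the (L3) slot `W80` the W₂-rows (88) `−(Δ_π HD(A′) + 𝔇*(A′)H*Δ_π A′)` were typed through `M_Δ = ‖Δπ‖_{(1,2)→(−3)}`, which grows like `η⁻¹`; print lets
`Δ_π` act only through `(Δ_π + DRD*)∘H̃`.  By `B11Eq88LaplaceH1Identity` (`Δ̃_{1,a}H̃₁ = Q†K̃⁻¹`, (45) `QH̃₁ = 1`) this composite is `Q_k†(K̃⁻¹ − a)`; its local sup
letter is `B9Eq3132QadjKinvPiSupRowClosed` + the `Q_k†` station; this file reads it on the (115) carriers exactly as (B) `B9Eq3126H1kPiOneBlockColumn` read `H̃`.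

WHAT THIS FILE PROVES (0 def, 0 sorry, axioms standard).  §1 **`exists_local_letter_QadjKinvSub`** — `∃ (α₁, j₁, B, δ)` BEFORE (K80)'s binder block:
`‖(Q_k†K̃⁻¹z − a·Q_k†z)(b)‖ ≤ B·e^{−δ·d_m(Π(b₋), v)}·F` for `z` supported over the bonds at `v`, `‖z‖_∞ ≤ F` (`B = B_QK + a·M_Q†·e^{δ}`).  §2
**`exists_oneBlock_letter_laplaceH1_current`** — same `∃`-prefix and block, then for every level profile `lev₀, lev₁, levB`, derivative letter `Dc`, coarse
bond `y`, `Z ∈ 𝔸`, fine bond `b`: `‖(currentCLM φ lev₁ Dc (Δ̃_{a,k} − Q_k†∘(aQ_k)) (H̃_{1,k}(δ_yZ)))(b)‖ ≤ M_φ·B·M_φ′·e^{−δ·d_m(Π(b₋), y₋)}·‖Z‖` where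
`Δ̃_{a,k} = laplaceAkPi … a` is print's (3.122) operator of the chart and `H̃_{1,k} = H1LatticeCLM φ hposπ hQ lev₁ Dc` — the kernel ROW∕COLUMN letter from which
`N₁ = ‖currentCLM(π†Δ^ηπ + DR_kD*) ∘ H̃_{1,k}‖_{𝒳 → (−3)} ≤ ω³·Ω·(2d)·K_d(δ)·M_φBM_φ′` follows by the column count of (B)∕(D-θ).

HONEST SCOPE.  Letter algebra on the cell's MODEL (O-NE9-1; #5 UNRULED); `hpos′ hpos hposπ hQ`, the windows, `c₀ = η^d`, `‖J‖ ≤ j₀` HYPOTHESES; constants crude;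
NOT the re-typed Prop. 4 for `W80` (g98 (E′)(1)); NE9 NOT PRINTED ∕ NOT PROVED; spine PROVED 0∕9; rung (B)+1 on a finite T⁴ — NOT infinite volume, NOT mass gap,
NOT Clay.  HONEST DEPENDENCY: continuum YM on T⁴ ⇐ BetaPertH ∧ nine spine estimates (0/9 proved); BetaPertH ⇐ (D1) ∧ (D4) ∧ CAP+tail; G-an2-4 gates asym, D1
and NE2/3/4.  NEW file; nothing modified.  Net new unproved facts: 0.
-/

noncomputable section

set_option autoImplicit false

open scoped InnerProductSpace ComplexConjugate BigOperators

namespace Literature.MathematicalPhysics.QuantumFieldTheory.Balaban1983to89.B11Eq88LaplaceH1CurrentLetter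



open B4Sect5Torus (TSite tdist tdist_nonneg tdist_symm tdist_self tdist_triangle torusSum_le)
open B4Sect5Proof (latticeConst latticeConst_nonneg)
open B9SectCLatticeCarrier (Bond DirPair bpos btgt shift unshift)
open B9Eq311L2Pairing (WL2)
open B9Eq319QprimeTorus (fineP blockCoord)
open B7Prop1Explicit (U1 Wcx boxVec)
open B11Eq103H1Complex (SiteL2K BondL2K greenK covDerivL2K covDivL2K G1LatticeK KinvLatticeK H1LatticeK H1LatticeK_eq)
open B9Eq310DeltaPrime (plaqHolU)
open B9Eq310HessianOperator (adTransportW hessOp)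
open B9Eq310HessianHermitian (adTransportW_adjoint)
open B9Eq315QTorus (perCfg cornerSite)
open B9Eq315QTower (towerP UlevOf)
open B9Eq316TowerFlatIsOneStep (towerP_eq_fineP_pow siteCast)
open B9Eq326OperatorTower (QprimeTowerW QkW RofUk laplaceAk G1k)
open B9Eq324DeltaPrimeATower (laplacePrimeAk GpOfUk)
open B9Eq33CovDerivLocalLetterTower (tdist_bigBlock_bpos_btgt_le_one)
open B9Eq3117GaugeModeStencilLettersTower (local_hessOp_covDerivL2K_tower local_covDivL2K_hessOp_tower)
open B9Eq3132QGtildeQInvLetterClosed (exists_local_letter_KinvLatticeKPi)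
open B9Eq3132QadjKinvPiSupRowClosed (exists_local_letter_QadjKinvLatticeKPi)
open B11Eq88LaplaceH1Identity (laplaceALatticeK_H1LatticeK)
open B9Eq3119DeltaPiCarrier (currentCLM equiv_currentCLM)
open B11Eq103H1Complex (H1LatticeCLM H1CLM_apply funEquiv funEquiv_symm_apply Q_H1LatticeK)
open B11Eq90V0primeCurrent (flat115 flat115_apply)
open B11Eq115Space
open B9Eq3119DeltaPiTower (piOfUk laplaceAkPi)

variable {d : ℕ} (hd : 1 ≤ d) (L : ℕ) [NeZero L] (hL : 1 ≤ L) (hL3 : 3 ≤ L)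
  {𝔸 : Type*} [NormedRing 𝔸] [NormedAlgebra ℂ 𝔸] [CompleteSpace 𝔸] [NormOneClass 𝔸] [StarRing 𝔸] [NormedStarGroup 𝔸] [StarModule ℂ 𝔸]
  {W : Type*} [NormedAddCommGroup W] [InnerProductSpace ℂ W] [FiniteDimensional ℂ W] (φ : W ≃ₗ[ℂ] 𝔸)
  {Mφ Mφ' : ℝ} (hMφ : 0 ≤ Mφ) (hMφ' : 0 ≤ Mφ') (hφ : ∀ w, ‖φ w‖ ≤ Mφ * ‖w‖) (hφ' : ∀ X, ‖φ.symm X‖ ≤ Mφ' * ‖X‖) (hstar : ∀ X : 𝔸, ‖star X‖ ≤ ‖X‖)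
  {a : ℝ} (ha : 0 < a) {a' : ℝ} (ha' : 0 < a') {ϱ : ℝ} (hϱ0 : 0 ≤ ϱ) (hϱ1 : ϱ < 1)
  (τ : 𝔸 →ₗ[ℂ] ℂ) {Cτ : ℝ} (hτ : ∀ X, ‖τ X‖ ≤ Cτ * ‖X‖) (hCτ : 0 ≤ Cτ) {Mτ : ℝ} (hτm : ∀ X Y : 𝔸, ‖τ (X * Y)‖ ≤ Mτ * ‖X‖ * ‖Y‖) (hMτ : 0 ≤ Mτ)
  {ρw : ℝ} (hρw : 0 ≤ ρw)
  (hτ₁ : ∀ X : 𝔸, τ (star X) = conj (τ X)) (hτ₂ : ∀ X Y : 𝔸, τ (X * Y) = τ (Y * X)) (hφτ : ∀ X Y : 𝔸, ⟪φ.symm X, φ.symm Y⟫_ℂ = τ (star X * Y))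
  (AQ : ℝ)

open B9Eq326G1SupRowOfLetters (letter_comp letter_mono)
open B9Eq3126H1SupRowOfLetters (letter_of_range local_letter_H1_of_letters)
open B9Eq349BlockDistanceWeight (tdist_shift_le_one)
open B9Eq315QkSingleBondLetter (norm_adjoint_QkW_apply_le_local_sharp)

set_option maxHeartbeats 400000 in -- (K80)'s ≈ 50-binder block
include hd hL hL3 hMφ hMφ' hφ hφ' hstar ha ha' hϱ0 hϱ1 hτ hCτ hτm hMτ hρw hτ₁ hτ₂ hφτ in
/-- **THE LOCAL SUP LETTER OF `Q_k†((Q_kG̃_kQ_k†)⁻¹ − a)`** — `B9Eq3132QadjKinvPiSupRowClosed` plus the `Q_k†` station (size `M_Q†`, range `1`, `letter_of_range` at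
the same rate), triangle inequality. [cite: Balaban1985BackgroundPropagators, (3.132)–(3.133) p.422; Balaban1985Variational, (88) p.291] -/
theorem exists_local_letter_QadjKinvSub :
    ∃ α₁ j₁ B δ : ℝ, 0 < α₁ ∧ 0 < j₁ ∧ 0 ≤ B ∧ 0 < δ ∧
      ∀ (n : ℕ) (η : ℝ) (_hηL : η * (L : ℝ) ^ (n + 1) = 1) (c₀ c₁ : ℝ) [Fact (0 < c₀)] [Fact (0 < c₁)]
        (_hw : c₀ * ((L : ℝ) ^ (n + 1)) ^ d = c₁) (_hρ : |η| ^ d / c₀ ≤ ρw) (m : Fin d → ℕ) [∀ i, NeZero (m i)] (_hm : ∀ i, 1 ≤ m i)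
        (U : Bond d (towerP L m (n + 1)) → 𝔸ˣ) (αU : ℕ → ℝ) (_hα0 : ∀ j, 0 ≤ αU j) (hα1 : ∀ j, αU j ≤ 1 / 64)
        (hαL : ∀ j, 50 * (d + 1) * αU j * (L : ℝ) ^ d ≤ 1 / 2)
        (hU1 : ∀ (j : ℕ) (x : B7Prop1Explicit.Site d) (k : Fin d), perCfg (towerP L m (j + 1)) (UlevOf L m (n + 1) U j) x k ∈ U1 𝔸)
        (hreg : ∀ (j : ℕ) (y : TSite d (towerP L m j)) (k : Fin d) (ρ' : Fin d → Fin L),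
          ‖((Wcx L (perCfg (towerP L m (j + 1)) (UlevOf L m (n + 1) U j)) (cornerSite L y) k (boxVec L ρ') : 𝔸ˣ) : 𝔸) - 1‖ ≤ αU j)
        (εU : ℕ → ℝ) (_hεU : ∀ j, 0 ≤ εU j) (_hUε : ∀ (j : ℕ) (b : Bond d (towerP L m (j + 1))), ‖(UlevOf L m (n + 1) U j b : 𝔸) - 1‖ ≤ εU j)
        (_hLb : ∀ (j : ℕ) (b : Bond d (towerP L m (j + 1))), UlevOf L m (n + 1) U j b ∈ U1 𝔸)
        (α : ℝ) (_hα : 0 ≤ α) (_hαle : α ≤ α₁)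
        (hUst : ∀ b, star (U b : 𝔸) = (((U b)⁻¹ : 𝔸ˣ) : 𝔸)) (_hUb : ∀ b, U b ∈ U1 𝔸) (_hUη : ∀ b, ‖(U b : 𝔸) - 1‖ ≤ α * η)
        (_hpl : ∀ p : B9SectCLatticeCarrier.Plaq d (towerP L m (n + 1)), ‖(plaqHolU U p : 𝔸) - 1‖ ≤ α * η ^ 2)
        (_hUgrad : ∀ (x : TSite d (towerP L m (n + 1))) (μ : Fin d), ‖(U (x, μ) : 𝔸) - U (unshift μ x, μ)‖ ≤ α * η ^ 2)
        (_hRlev : ∀ (j : ℕ) (b : Bond d (towerP L m (j + 1))) (w : W), ‖adTransportW φ (UlevOf L m (n + 1) U j) b w‖ ≤ ‖w‖)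
        (_hεg : ∀ j < n + 1, εU j ≤ α * ϱ ^ j) (_hAQ : ∑ j ∈ Finset.range (n + 1), αU j ≤ AQ)
        (hpos' : ∀ x : SiteL2K ℂ d (towerP L m (n + 1)) c₀ W, x ≠ 0 → 0 < RCLike.re ⟪x, laplacePrimeAk L m n φ η U a' (c₁ := c₁) x⟫_ℂ)
        (hpos : ∀ x : BondL2K ℂ d (towerP L m (n + 1)) c₀ W, x ≠ 0 →
          0 < RCLike.re ⟪x, laplaceAk L m n φ η U hL αU hα1 hU1 hreg τ (c₀ := c₀) (c₁ := c₁) a x⟫_ℂ)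
        (_hc₀η : c₀ = η ^ d) (j₀ : ℝ) (_hJ : ∀ μ y, ‖B9Eq39Adjoint.J (fun μ => B9Eq33CovDerivVector.shiftEquiv μ) (fun μ y => U (y, μ)) η μ y‖ ≤ j₀) (_hj : j₀ ≤ j₁)
        (hposπ : ∀ x : BondL2K ℂ d (towerP L m (n + 1)) c₀ W, x ≠ 0 →
          0 < RCLike.re ⟪x, laplaceAkPi L m n φ τ η U a' hpos' hL αU hα1 hU1 hreg (c₁ := c₁) a x⟫_ℂ)
        (hQ : Function.Surjective (QkW L m n φ U hL αU hα1 hU1 hreg (c₀ := c₀) (c₁ := c₁)))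
        (v : TSite d m) (z : BondL2K ℂ d m c₁ W) (F : ℝ)
        (_hzv : ∀ b', bpos b' ≠ v → WL2.equiv ℂ (fun _ : Bond d m => c₁) W z b' = 0)
        (_hzF : ∀ b', ‖WL2.equiv ℂ (fun _ : Bond d m => c₁) W z b'‖ ≤ F) (b : Bond d (towerP L m (n + 1))),
        ‖WL2.equiv ℂ (fun _ : Bond d (towerP L m (n + 1)) => c₀) W
            (LinearMap.adjoint (QkW L m n φ U hL αU hα1 hU1 hreg (c₀ := c₀) (c₁ := c₁)) (KinvLatticeK hposπ hQ z)
              - (a : ℂ) • LinearMap.adjoint (QkW L m n φ U hL αU hα1 hU1 hreg (c₀ := c₀) (c₁ := c₁)) z) b‖ ≤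
          B * Real.exp (-(δ * tdist m (blockCoord (L ^ (n + 1)) m (siteCast (towerP_eq_fineP_pow L m (n + 1)) (bpos b))) v)) * F := by
  classical
  obtain ⟨αK, jK, BK, δK, hαK, hjK, hBK, hδK, HA⟩ :=
    exists_local_letter_QadjKinvLatticeKPi hd L hL hL3 φ hMφ hMφ' hφ hφ' hstar ha ha' hϱ0 hϱ1 τ hτ hCτ hτm hMτ hρw hτ₁ hτ₂ hφτ AQ
  obtain ⟨MQa, hMQa⟩ : ∃ M : ℝ, M = Mφ' * Real.exp (100 * d * (d + 1) * (L : ℝ) ^ d * AQ) * Mφ * ((2 * d : ℕ) : ℝ) := ⟨_, rfl⟩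
  have hMQa0 : 0 ≤ MQa := by rw [hMQa]; positivity
  obtain ⟨Bs, hBs⟩ : ∃ B : ℝ, B = BK + a * (MQa * Real.exp (δK * 1)) := ⟨_, rfl⟩
  have hBs0 : 0 ≤ Bs := by rw [hBs]; have := ha.le; positivity
  refine ⟨αK, jK, Bs, δK, hαK, hjK, hBs0, hδK, ?_⟩
  intro n η hηL c₀ c₁ _ _ hw hρ m _ hm U αU hα0 hα1 hαL hU1 hreg εU hεU hUε hLb α hα hαle hUst hUb hUη hpl hUgrad hRlev hεg hAQ hpos' hpos hc₀η j₀ hJ hj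
    hposπ hQ v z F hzv hzF b
  have hc₀ : (0 : ℝ) < c₀ := Fact.out
  haveI : Nonempty (Bond d m) := ⟨(v, ⟨0, hd⟩)⟩
  have b' : Bond d m := (v, ⟨0, hd⟩)
  have hF0 : 0 ≤ F := (norm_nonneg _).trans (hzF (v, ⟨0, hd⟩))
  have h1 := HA n η hηL c₀ c₁ hw hρ m hm U αU hα0 hα1 hαL hU1 hreg εU hεU hUε hLb α hα hαle hUst hUb hUη hpl hUgrad hRlev hεg hAQ hpos' hpos hc₀η j₀ hJ hj
    hposπ hQ v z F hzv hzF b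
  -- (L)(Q_k†; M_Q†·e^δ, δ): size from the single-bond letter, range `1`
  obtain ⟨Qacl, hQacl⟩ : ∃ T : BondL2K ℂ d m c₁ W →L[ℂ] BondL2K ℂ d (towerP L m (n + 1)) c₀ W,
      T = LinearMap.toContinuousLinearMap (LinearMap.adjoint (QkW L m n φ U hL αU hα1 hU1 hreg (c₀ := c₀) (c₁ := c₁))) := ⟨_, rfl⟩
  have hdiag : c₁ / c₀ * (Mφ' * ((((L : ℝ) ^ (n + 1)) ^ d)⁻¹ * Real.exp (100 * d * (d + 1) * (L : ℝ) ^ d * AQ)) * Mφ) * ((2 * d : ℕ) : ℝ) = MQa := by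
    have hLp : (0 : ℝ) < ((L : ℝ) ^ (n + 1)) ^ d := pow_pos (pow_pos (Nat.cast_pos.2 hL) _) _
    rw [hMQa, ← hw]
    field_simp
  have hQaM : ∀ (z : BondL2K ℂ d m c₁ W) (F : ℝ), (∀ x, ‖WL2.equiv ℂ (fun _ : Bond d m => c₁) W z x‖ ≤ F) →
      ∀ x, ‖WL2.equiv ℂ (fun _ : Bond d (towerP L m (n + 1)) => c₀) W (Qacl z) x‖ ≤ MQa * F := by
    intro z F hzF x
    have hF : 0 ≤ F := (norm_nonneg _).trans (hzF b')
    have h := norm_adjoint_QkW_apply_le_local_sharp L m n φ (c₀ := c₀) U hL αU hα0 hα1 hU1 hreg hMφ hφ hMφ' hφ' hAQ z x hF (fun c _ => hzF c)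
    rw [hQacl, LinearMap.coe_toContinuousLinearMap', ← hdiag]
    exact h
  have hQaρ : ∀ (v : TSite d m) (z : BondL2K ℂ d m c₁ W), (∀ x, bpos x ≠ v → WL2.equiv ℂ (fun _ : Bond d m => c₁) W z x = 0) →
      ∀ x, (1 : ℝ) < tdist m (blockCoord (L ^ (n + 1)) m (siteCast (towerP_eq_fineP_pow L m (n + 1)) (bpos x))) v →
        WL2.equiv ℂ (fun _ : Bond d (towerP L m (n + 1)) => c₀) W (Qacl z) x = 0 := by
    intro v z hzv x hx
    have hnear : ∀ c : Bond d m, (blockCoord (L ^ (n + 1)) m (siteCast (towerP_eq_fineP_pow L m (n + 1)) x.1) = c.1 ∨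
        blockCoord (L ^ (n + 1)) m (siteCast (towerP_eq_fineP_pow L m (n + 1)) x.1) = shift c.2 c.1) →
        ‖WL2.equiv ℂ (fun _ : Bond d m => c₁) W z c‖ ≤ 0 := by
      intro c hc
      have hcv : bpos c ≠ v := by
        intro hcv
        rcases hc with h1 | h2
        · have : tdist m (blockCoord (L ^ (n + 1)) m (siteCast (towerP_eq_fineP_pow L m (n + 1)) (bpos x))) v = 0 := by
            rw [show bpos x = x.1 from rfl, h1, show c.1 = bpos c from rfl, hcv, tdist_self]
          linarith only [this, hx]
        · have : tdist m (blockCoord (L ^ (n + 1)) m (siteCast (towerP_eq_fineP_pow L m (n + 1)) (bpos x))) v ≤ 1 := by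
            rw [show bpos x = x.1 from rfl, h2, show c.1 = bpos c from rfl, hcv, tdist_symm hm]
            exact tdist_shift_le_one hm v c.2
          linarith only [this, hx]
      rw [hzv c hcv, norm_zero]
    have h := norm_adjoint_QkW_apply_le_local_sharp L m n φ (c₀ := c₀) U hL αU hα0 hα1 hU1 hreg hMφ hφ hMφ' hφ' hAQ z x le_rfl hnear
    rw [mul_zero] at h
    rw [hQacl, LinearMap.coe_toContinuousLinearMap']
    exact norm_le_zero_iff.1 h
  have h2 := letter_of_range (tdist m) (fun c : Bond d m => bpos c)
    (fun x : Bond d (towerP L m (n + 1)) => blockCoord (L ^ (n + 1)) m (siteCast (towerP_eq_fineP_pow L m (n + 1)) (bpos x))) Qacl (M := MQa) (ρ := 1)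
    (κ := δK) hδK.le hQaM hQaρ v z F hzv hzF b
  rw [hQacl, LinearMap.coe_toContinuousLinearMap'] at h2
  -- triangle
  rw [WL2.equiv_sub, WL2.equiv_smul, Pi.sub_apply, Pi.smul_apply]
  refine (norm_sub_le _ _).trans ?_
  rw [norm_smul, Complex.norm_real, Real.norm_of_nonneg ha.le, hBs]
  have e : (BK + a * (MQa * Real.exp (δK * 1))) *
        Real.exp (-(δK * tdist m (blockCoord (L ^ (n + 1)) m (siteCast (towerP_eq_fineP_pow L m (n + 1)) (bpos b))) v)) * F
      = BK * Real.exp (-(δK * tdist m (blockCoord (L ^ (n + 1)) m (siteCast (towerP_eq_fineP_pow L m (n + 1)) (bpos b))) v)) * F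
        + a * (MQa * Real.exp (δK * 1) * Real.exp (-(δK * tdist m (blockCoord (L ^ (n + 1)) m (siteCast (towerP_eq_fineP_pow L m (n + 1)) (bpos b))) v)) * F) := by
    ring
  rw [e]
  exact add_le_add h1 (mul_le_mul_of_nonneg_left h2 ha.le)

set_option maxRecDepth 8192 in
set_option maxHeartbeats 800000 in -- (K80)'s ≈ 50-binder block + the carrier reading
include hd hL hL3 hMφ hMφ' hφ hφ' hstar ha ha' hϱ0 hϱ1 hτ hCτ hτm hMτ hρw hτ₁ hτ₂ hφτ in
/-- **THE ONE-BLOCK LETTER OF `(Δ̃_{a,k} − Q_k†aQ_k)∘H̃_{1,k}` READ AS CURRENTS**: `‖(currentCLM … (laplaceAkPi … a − Q_k†∘(aQ_k)) (H̃_{1,k}(δ_yZ)))(b)‖ ≤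
M_φ·B·M_φ′·e^{−δ·d_m(Π(b₋), y₋)}·‖Z‖`, `∃ (α₁, j₁, B, δ)` BEFORE the lattice — §1 at the one-block field `φ⁻¹∘δ_yZ`, the readers `equiv_currentCLM` ∕ `H1CLM_apply`
unfolded, and `Δ̃_{a,k}(H̃_{1,k}z) − Q_k†(aQ_kH̃_{1,k}z) = Q_k†K̃⁻¹z − a·Q_k†z` by (129) + (45).
[cite: Balaban1985Variational, (87)–(88) p.291, (129) p.297, (45) p.285; Balaban1985BackgroundPropagators, (3.122) p.420, (3.132) p.422] -/
theorem exists_oneBlock_letter_laplaceH1_current :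
    ∃ α₁ j₁ B δ : ℝ, 0 < α₁ ∧ 0 < j₁ ∧ 0 ≤ B ∧ 0 < δ ∧
      ∀ (n : ℕ) (η : ℝ) (_hηL : η * (L : ℝ) ^ (n + 1) = 1) (c₀ c₁ : ℝ) [Fact (0 < c₀)] [Fact (0 < c₁)]
        (_hw : c₀ * ((L : ℝ) ^ (n + 1)) ^ d = c₁) (_hρ : |η| ^ d / c₀ ≤ ρw) (m : Fin d → ℕ) [∀ i, NeZero (m i)] (_hm : ∀ i, 1 ≤ m i)
        (U : Bond d (towerP L m (n + 1)) → 𝔸ˣ) (αU : ℕ → ℝ) (_hα0 : ∀ j, 0 ≤ αU j) (hα1 : ∀ j, αU j ≤ 1 / 64)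
        (hαL : ∀ j, 50 * (d + 1) * αU j * (L : ℝ) ^ d ≤ 1 / 2)
        (hU1 : ∀ (j : ℕ) (x : B7Prop1Explicit.Site d) (k : Fin d), perCfg (towerP L m (j + 1)) (UlevOf L m (n + 1) U j) x k ∈ U1 𝔸)
        (hreg : ∀ (j : ℕ) (y : TSite d (towerP L m j)) (k : Fin d) (ρ' : Fin d → Fin L),
          ‖((Wcx L (perCfg (towerP L m (j + 1)) (UlevOf L m (n + 1) U j)) (cornerSite L y) k (boxVec L ρ') : 𝔸ˣ) : 𝔸) - 1‖ ≤ αU j)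
        (εU : ℕ → ℝ) (_hεU : ∀ j, 0 ≤ εU j) (_hUε : ∀ (j : ℕ) (b : Bond d (towerP L m (j + 1))), ‖(UlevOf L m (n + 1) U j b : 𝔸) - 1‖ ≤ εU j)
        (_hLb : ∀ (j : ℕ) (b : Bond d (towerP L m (j + 1))), UlevOf L m (n + 1) U j b ∈ U1 𝔸)
        (α : ℝ) (_hα : 0 ≤ α) (_hαle : α ≤ α₁)
        (hUst : ∀ b, star (U b : 𝔸) = (((U b)⁻¹ : 𝔸ˣ) : 𝔸)) (_hUb : ∀ b, U b ∈ U1 𝔸) (_hUη : ∀ b, ‖(U b : 𝔸) - 1‖ ≤ α * η)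
        (_hpl : ∀ p : B9SectCLatticeCarrier.Plaq d (towerP L m (n + 1)), ‖(plaqHolU U p : 𝔸) - 1‖ ≤ α * η ^ 2)
        (_hUgrad : ∀ (x : TSite d (towerP L m (n + 1))) (μ : Fin d), ‖(U (x, μ) : 𝔸) - U (unshift μ x, μ)‖ ≤ α * η ^ 2)
        (_hRlev : ∀ (j : ℕ) (b : Bond d (towerP L m (j + 1))) (w : W), ‖adTransportW φ (UlevOf L m (n + 1) U j) b w‖ ≤ ‖w‖)
        (_hεg : ∀ j < n + 1, εU j ≤ α * ϱ ^ j) (_hAQ : ∑ j ∈ Finset.range (n + 1), αU j ≤ AQ)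
        (hpos' : ∀ x : SiteL2K ℂ d (towerP L m (n + 1)) c₀ W, x ≠ 0 → 0 < RCLike.re ⟪x, laplacePrimeAk L m n φ η U a' (c₁ := c₁) x⟫_ℂ)
        (hpos : ∀ x : BondL2K ℂ d (towerP L m (n + 1)) c₀ W, x ≠ 0 →
          0 < RCLike.re ⟪x, laplaceAk L m n φ η U hL αU hα1 hU1 hreg τ (c₀ := c₀) (c₁ := c₁) a x⟫_ℂ)
        (_hc₀η : c₀ = η ^ d) (j₀ : ℝ) (_hJ : ∀ μ y, ‖B9Eq39Adjoint.J (fun μ => B9Eq33CovDerivVector.shiftEquiv μ) (fun μ y => U (y, μ)) η μ y‖ ≤ j₀) (_hj : j₀ ≤ j₁)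
        (hposπ : ∀ x : BondL2K ℂ d (towerP L m (n + 1)) c₀ W, x ≠ 0 →
          0 < RCLike.re ⟪x, laplaceAkPi L m n φ τ η U a' hpos' hL αU hα1 hU1 hreg (c₁ := c₁) a x⟫_ℂ)
        (hQ : Function.Surjective (QkW L m n φ U hL αU hα1 hU1 hreg (c₀ := c₀) (c₁ := c₁)))
        [FiniteDimensional ℂ 𝔸] (lev₀ : Bond d (towerP L m (n + 1)) → ℕ) {κ' : Type*} [Fintype κ'] (lev₁ : κ' → ℕ)
        (Dc : (Bond d (towerP L m (n + 1)) → 𝔸) →ₗ[ℂ] (κ' → 𝔸)) (levB : Bond d m → ℕ) [Fact (0 < (L : ℝ))] [Fact (0 < η)]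
        (y : Bond d m) (Z : 𝔸) (b : Bond d (towerP L m (n + 1))),
        ‖NegSup.equiv (levWeight (L : ℝ) η lev₀ 3) 𝔸
            (currentCLM φ lev₁ Dc
              (laplaceAkPi L m n φ τ η U a' hpos' hL αU hα1 hU1 hreg (c₁ := c₁) a
                - LinearMap.adjoint (QkW L m n φ U hL αU hα1 hU1 hreg (c₀ := c₀) (c₁ := c₁)) ∘ₗ
                    ((a : ℂ) • QkW L m n φ U hL αU hα1 hU1 hreg (c₀ := c₀) (c₁ := c₁)))
              (H1LatticeCLM (L := (L : ℝ)) (η := η) (lev₀ := lev₀) (levB := levB) φ hposπ hQ lev₁ Dc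
                ((NegSup.equiv (levWeight (L : ℝ) η levB 0) 𝔸).symm (Pi.single y Z)))) b‖ ≤
          Mφ * B * Mφ' * Real.exp (-(δ * tdist m (blockCoord (L ^ (n + 1)) m (siteCast (towerP_eq_fineP_pow L m (n + 1)) (bpos b))) (bpos y))) * ‖Z‖ := by
  obtain ⟨α₁, j₁, B, δ, hα₁, hj₁, hB, hδ, HK⟩ :=
    exists_local_letter_QadjKinvSub hd L hL hL3 φ hMφ hMφ' hφ hφ' hstar ha ha' hϱ0 hϱ1 τ hτ hCτ hτm hMτ hρw hτ₁ hτ₂ hφτ AQ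
  refine ⟨α₁, j₁, B, δ, hα₁, hj₁, hB, hδ, ?_⟩
  intro n η hηL c₀ c₁ _ _ hw hρ m _ hm U αU hα0 hα1 hαL hU1 hreg εU hεU hUε hLb α hα hαle hUst hUb hUη hpl hUgrad hRlev hεg hAQ hpos' hpos hc₀η j₀ hJ hj
    hposπ hQ _ lev₀ κ' _ lev₁ Dc levB _ _ y Z b
  -- the one-block field read in the Hilbert fibre: supported at `y₋`, values bounded by `M_φ′‖Z‖`
  have hzv : ∀ b', bpos b' ≠ bpos y → WL2.equiv ℂ (fun _ : Bond d m => c₁) W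
      ((funEquiv φ (fun _ : Bond d m => c₁)).symm (Pi.single y Z)) b' = 0 := by
    intro b' hb'
    have hne : b' ≠ y := fun h => hb' (by rw [h])
    rw [funEquiv_symm_apply, Pi.single_eq_of_ne hne, map_zero]
  have hzF : ∀ b', ‖WL2.equiv ℂ (fun _ : Bond d m => c₁) W ((funEquiv φ (fun _ : Bond d m => c₁)).symm (Pi.single y Z)) b'‖ ≤ Mφ' * ‖Z‖ := by
    intro b'
    rw [funEquiv_symm_apply]
    refine (hφ' _).trans (mul_le_mul_of_nonneg_left ?_ hMφ')
    by_cases h : b' = y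
    · rw [h, Pi.single_eq_same]
    · rw [Pi.single_eq_of_ne h, norm_zero]; exact norm_nonneg _
  have h := HK n η hηL c₀ c₁ hw hρ m hm U αU hα0 hα1 hαL hU1 hreg εU hεU hUε hLb α hα hαle hUst hUb hUη hpl hUgrad hRlev hεg hAQ hpos' hpos hc₀η j₀ hJ hj
    hposπ hQ (bpos y) ((funEquiv φ (fun _ : Bond d m => c₁)).symm (Pi.single y Z)) (Mφ' * ‖Z‖) hzv hzF b
  -- the reading: `current(T)(H̃ B)` at `b` is `φ` of `T(H̃_k z)` at `b`, and `T(H̃_k z) = Q_k†K̃⁻¹z − a·Q_k†z` by (129) + (45)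
  have e1 : flat115 (H1LatticeCLM (L := (L : ℝ)) (η := η) (lev₀ := lev₀) (levB := levB) φ hposπ hQ lev₁ Dc
        ((NegSup.equiv (levWeight (L : ℝ) η levB 0) 𝔸).symm (Pi.single y Z)))
      = funEquiv φ (fun _ : Bond d (towerP L m (n + 1)) => c₀) (H1LatticeK hposπ hQ
          ((funEquiv φ (fun _ : Bond d m => c₁)).symm (NegSup.equiv (levWeight (L : ℝ) η levB 0) 𝔸
            ((NegSup.equiv (levWeight (L : ℝ) η levB 0) 𝔸).symm (Pi.single y Z))))) := rfl
  rw [equiv_currentCLM, e1, LinearEquiv.symm_apply_apply, Equiv.apply_symm_apply, LinearMap.sub_apply, LinearMap.comp_apply,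
    LinearMap.smul_apply, map_smul]
  erw [laplaceALatticeK_H1LatticeK hposπ hQ, Q_H1LatticeK hposπ hQ]
  refine (hφ _).trans ?_
  calc Mφ * ‖WL2.equiv ℂ (fun _ : Bond d (towerP L m (n + 1)) => c₀) W
          (LinearMap.adjoint (QkW L m n φ U hL αU hα1 hU1 hreg (c₀ := c₀) (c₁ := c₁)) (KinvLatticeK hposπ hQ
              ((funEquiv φ (fun _ : Bond d m => c₁)).symm (Pi.single y Z)))
            - (a : ℂ) • LinearMap.adjoint (QkW L m n φ U hL αU hα1 hU1 hreg (c₀ := c₀) (c₁ := c₁))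
              ((funEquiv φ (fun _ : Bond d m => c₁)).symm (Pi.single y Z))) b‖
      ≤ Mφ * (B * Real.exp (-(δ * tdist m (blockCoord (L ^ (n + 1)) m (siteCast (towerP_eq_fineP_pow L m (n + 1)) (bpos b))) (bpos y))) * (Mφ' * ‖Z‖)) :=
        mul_le_mul_of_nonneg_left h hMφ
    _ = _ := by ring

end Literature.MathematicalPhysics.QuantumFieldTheory.Balaban1983to89.B11Eq88LaplaceH1CurrentLetter

end
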